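/-
Copyright: H21 programme, solo seat `solo-RiemannHypothesis-informed` (session 4).
-/
import Summits.RiemannHypothesis.RiemannHypothesis.Theorems.SoloInformedDoubleLogMain

/-!
# The double-log theorem as local rigidity (solo-informed, T20)

The exclusion form of T18 (`weilGroundEnergy_neg_of_local_doubleLog_offset`): Weil positivity at ONE
window upgrades "RH near `γ₀` with at most one exceptional pair `½ ± |η| + iγ₀`" to "RH near `γ₀`".
Precisely: for `η ≠ 0`, `|η| < ½` there is `c₀(η) ≥ 0` such that for `|γ₀| ≥ 1`,
`c ≥ c₀(η) + log log(|γ₀|+2)/(2|η|)`, `R ≥ 1`, `e^{c+1} ≤ R²`: if every zero with `0 ≤ Re ρ ≤ 1`,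
`|Im ρ − γ₀| < R` is on the critical line or is one of `½ ± |η| + iγ₀`, and the Weil form is
nonnegative on tests supported in `[−(c+1), c+1]` (`0 ≤ ε(c+1)`), then `ζ(½ + η + iγ₀) ≠ 0` — the
exceptional pair is not there either (`riemannZeta_ne_zero_of_local_of_weilGroundEnergy_nonneg`).
An isolated off-line pair cannot hide from double-log-window positivity.
-/

open Complex Literature.NumberTheory.LFunctions

namespace Summit.RiemannHypothesis.RiemannHypothesis.Theorems

/-- **Local rigidity (T20).** Weil positivity at the double-log window plus local RH up to one
exceptional pair excludes the pair: contrapositive of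
`weilGroundEnergy_neg_of_local_doubleLog_offset`. -/
theorem riemannZeta_ne_zero_of_local_of_weilGroundEnergy_nonneg {η : ℝ} (hη0 : η ≠ 0)
    (hη : |η| < 1 / 2) :
    ∃ c₀ : ℝ, 0 ≤ c₀ ∧ ∀ (γ₀ c R : ℝ), 1 ≤ |γ₀| →
      c₀ + Real.log (Real.log (|γ₀| + 2)) / (2 * |η|) ≤ c → 1 ≤ R → Real.exp (c + 1) ≤ R ^ 2 →
      (∀ ρ : ℂ, riemannZeta ρ = 0 → 0 ≤ ρ.re → ρ.re ≤ 1 → |ρ.im - γ₀| < R → ρ.re ≠ 1 / 2 →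
          ρ = 1 / 2 + ↑|η| + γ₀ * I ∨ ρ = 1 / 2 - ↑|η| + γ₀ * I) →
      0 ≤ weilGroundEnergy (c + 1) →
      riemannZeta (1 / 2 + η + γ₀ * I) ≠ 0 := by
  obtain ⟨c₀, hc₀, hT⟩ := weilGroundEnergy_neg_of_local_doubleLog_offset hη0 hη
  refine ⟨c₀, hc₀, fun γ₀ c R hγ hc hR hRc hloc hpos hζ ↦ ?_⟩
  have := hT γ₀ c R hγ hc hR hRc hζ hloc
  linarith

/-- The same with both members of the pair excluded: under the hypotheses of T20 neither
`½ + |η| + iγ₀` nor `½ − |η| + iγ₀` is a zero, so RH holds throughout the window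
`|Im ρ − γ₀| < R` of the closed strip. -/
theorem local_rh_of_local_upto_pair_of_weilGroundEnergy_nonneg {η : ℝ} (hη0 : η ≠ 0)
    (hη : |η| < 1 / 2) :
    ∃ c₀ : ℝ, 0 ≤ c₀ ∧ ∀ (γ₀ c R : ℝ), 1 ≤ |γ₀| →
      c₀ + Real.log (Real.log (|γ₀| + 2)) / (2 * |η|) ≤ c → 1 ≤ R → Real.exp (c + 1) ≤ R ^ 2 →
      (∀ ρ : ℂ, riemannZeta ρ = 0 → 0 ≤ ρ.re → ρ.re ≤ 1 → |ρ.im - γ₀| < R → ρ.re ≠ 1 / 2 →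
          ρ = 1 / 2 + ↑|η| + γ₀ * I ∨ ρ = 1 / 2 - ↑|η| + γ₀ * I) →
      0 ≤ weilGroundEnergy (c + 1) →
      ∀ ρ : ℂ, riemannZeta ρ = 0 → 0 ≤ ρ.re → ρ.re ≤ 1 → |ρ.im - γ₀| < R → ρ.re = 1 / 2 := by
  have hpos : 0 < |η| := abs_pos.mpr hη0
  have hA : |(|η|)| < 1 / 2 := by rwa [abs_abs]
  have hB : |(-|η|)| < 1 / 2 := by rwa [abs_neg, abs_abs]
  obtain ⟨c₁, hc₁, h₁⟩ := riemannZeta_ne_zero_of_local_of_weilGroundEnergy_nonneg hpos.ne' hA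
  obtain ⟨c₂, hc₂, h₂⟩ := riemannZeta_ne_zero_of_local_of_weilGroundEnergy_nonneg (neg_ne_zero.mpr hpos.ne') hB
  refine ⟨max c₁ c₂, le_max_of_le_left hc₁, fun γ₀ c R hγ hc hR hRc hloc hE ρ hζ h0 h1 hd ↦ ?_⟩
  have hL0 : 0 ≤ Real.log (Real.log (|γ₀| + 2)) / (2 * |η|) := by
    apply div_nonneg _ (by positivity)
    apply Real.log_nonneg
    rw [Real.le_log_iff_exp_le (by positivity)]
    linarith [Real.exp_one_lt_d9, abs_nonneg γ₀]
  have e1 : |(|η|)| = |η| := abs_abs η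
  have e2 : |(-|η|)| = |η| := by rw [abs_neg, abs_abs]
  have hloc1 : ∀ ρ : ℂ, riemannZeta ρ = 0 → 0 ≤ ρ.re → ρ.re ≤ 1 → |ρ.im - γ₀| < R → ρ.re ≠ 1 / 2 →
      ρ = 1 / 2 + ↑|(|η|)| + γ₀ * I ∨ ρ = 1 / 2 - ↑|(|η|)| + γ₀ * I := by rw [e1]; exact hloc
  have hloc2 : ∀ ρ : ℂ, riemannZeta ρ = 0 → 0 ≤ ρ.re → ρ.re ≤ 1 → |ρ.im - γ₀| < R → ρ.re ≠ 1 / 2 →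
      ρ = 1 / 2 + ↑|(-|η|)| + γ₀ * I ∨ ρ = 1 / 2 - ↑|(-|η|)| + γ₀ * I := by rw [e2]; exact hloc
  have hc1 : c₁ + Real.log (Real.log (|γ₀| + 2)) / (2 * |(|η|)|) ≤ c := by
    rw [e1]; linarith [le_max_left c₁ c₂]
  have hc2 : c₂ + Real.log (Real.log (|γ₀| + 2)) / (2 * |(-|η|)|) ≤ c := by
    rw [e2]; linarith [le_max_right c₁ c₂]
  have n₁ := h₁ γ₀ c R hγ hc1 hR hRc hloc1 hE
  have n₂ := h₂ γ₀ c R hγ hc2 hR hRc hloc2 hE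
  by_contra hne
  rcases hloc ρ hζ h0 h1 hd hne with rfl | rfl
  · exact n₁ hζ
  · apply n₂
    push_cast
    rw [show (1 / 2 + -((|η| : ℝ) : ℂ) + γ₀ * I) = 1 / 2 - ((|η| : ℝ) : ℂ) + γ₀ * I by ring]
    exact hζ

end Summit.RiemannHypothesis.RiemannHypothesis.Theorems
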